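import Summits.QuantumFields.YangMills.Theorems.BalabanLadderROTDefs
import Summits.QuantumFields.YangMills.Theorems.LangevinControlUVOSLegsAtWeakCouplingCStubRopeRPPos
import Summits.QuantumFields.YangMills.Theorems.LangevinControlUVOSLegsFromFemtoAndGapStubAssemblyPlaneStringsDefect
import Summits.QuantumFields.YangMills.Theorems.LangevinControlUVOSLegsFromFemtoAndGapStubAssemblyInheritance
import Summits.QuantumFields.YangMills.Theorems.LangevinControlUVOSLegsFromFemtoAndGapStubAssemblyLowDegree
import HarnessLib

/-!
# Route `F4SubCurvatureDoor`, crux `SubCurvatureKernel` ⟨stmt-QuantumFields-23036⟩ — the REFLECTION-POSITIVITY RUNG: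
# normalised off-diagonal limit points of the legs are reflection positive (`RPPos`) under `MomentBounds6`

Helper file (`--supports stmt-QuantumFields-23036 --as helper`; free-hands seat `ym-line-frs-p2` g17, clause (R) of the soft-half
scope, HOME INBOX 2026-08-29T16:34:27Z/16:34:43Z).  Definition-free, 0 sorry, standard axioms.  No item is closed; no summit, no
crux and no mass gap is proved by this file.

WHY.  The crux `SubCurvatureKernel` (route file `Theses/F4SubCurvatureDoor.lean` :338ff) wants, for every off-diagonal limit point `S₁`
of the legs (`OffDiagLimitAlong r sch φ S₁` under `MomentBounds6 G r a`, `IsLegScheme a sch`), a two-point kernel that is REFLECTION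
POSITIVE across `x₀ = 0`.  The tree proves «lattice RP ⇒ limit RP» (`RPPos`: E2 on finite tuples of positive-time off-diagonal test
functions) only for SOFT BUNDLES (✓`rpPos_of_softBundle`), whose export list carries the small-shift equicontinuity clause; for a bare
leg-scheme limit point two things are missing: (i) `OffDiagLimitAlong` constrains arity `0` only through the (automatic) density
clause, so `S₁ 0` is essentially free and `RPPos S₁` can fail for a trivial reason (e.g. `S₁ 0 = −δ`); (ii) the equicontinuity clause
has to be extracted from `MomentBounds6`.  This file settles both:

* §1 `exists_normalize`, `offDiagLimitAlong_normalize` — replacing `S₁ 0` by evaluation at the empty configuration keeps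
  `OffDiagLimitAlong` (arities `≥ 1` untouched; the arity-`0` density bound holds with constant `1`, the volume of the one-point space
  being a Dirac mass);
* §2 ★ `rpPos_of_offDiagLimitAlong` — under `MomentBounds6`, every off-diagonal limit point of an admissible leg scheme that is
  NORMALISED at arity `0` (`S₁ 0 F = F default`) satisfies `RPPos S₁`: ✓`rpPos_of_softLimit` (rope II / toolkit XXI) run along the
  TAIL of the scheme inside the regime `β ≥ β₄`, `a ≤ ℓ₄` (reached since `β_k → ∞`, `a → 0`), with convergence at arity `0`
  (✓`latticeDist_zero_apply`: the zero-point lattice distribution IS evaluation), arity `1` (✓`latticeDist_one_apply`: centred ⇒ `0`,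
  and `S₁ 1 = 0`), arities `≥ 2` (the `OffDiagLimitAlong` clause), and the equicontinuity clause supplied ONCE by toolkit XIV-b
  ✓`exists_planeString_bounds` (second conjunct) from `MomentBounds6`;
* §3 `rpPos_normalize_of_offDiagLimitAlong` — hence EVERY leg-scheme limit point has a normalisation that is again an
  `OffDiagLimitAlong` point, agrees with it at every arity `≥ 1` (in particular on the two-point function the crux's kernel
  represents) and satisfies `RPPos`; `isReflectionPositive_of_offDiagLimitAlong` (✓`isReflectionPositive_of_rpPos`); and the rung in
  the crux's quantifier prefix, `subCurvatureKernel_rung_rpPos`.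

References: K. Osterwalder, R. Schrader, CMP 31 (1973) §2 (E2); K. Osterwalder, E. Seiler, Ann. Phys. 110 (1978) §2–3 (reflection
positivity of the Wilson action); J. Glimm, A. Jaffe, Quantum Physics (1987) §6.1.

HONEST LABEL: one structural rung (E2) toward the SOFT half of ⟨23036⟩; kernel extraction (K), continuity off `0` (C), King faithfulness
(F) and the SUB-CURVATURE clause (asymptotic freedom) remain OPEN; ⟨23036⟩ is an open problem; the Yang–Mills mass gap is NOT proved; no
summit is proved by a line.
-/

set_option autoImplicit false

noncomputable section

open scoped SchwartzMap BigOperators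
open MeasureTheory Filter Topology
open Literature.MathematicalPhysics.QuantumFieldTheory Literature.MathematicalPhysics.QuantumLattice
open Literature.MathematicalPhysics.AQFT
open Literature.Probability.LatticeModels (box Site)
open Summit.QuantumFields.YangMills.Cruxes.OSLegsFromFemtoAndGap.DlrCollarTransfer
  (MomentBounds6 RPPos isReflectionPositive_of_rpPos)
open Summit.QuantumFields.YangMills.Cruxes.OSLegsAtWeakCouplingC.Sketch (Separated OffDiagDensity)
open Summit.QuantumFields.YangMills.Theorems.OSLegsFromFemtoAndGap
open Summit.QuantumFields.YangMills.Theorems.ROT (IsLegScheme OffDiagLimitAlong)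
open Summit.QuantumFields.YangMills.Theorems.NPointIsotropy.Negative (E4)

namespace Summit.QuantumFields.YangMills.Theorems.F4SubCurvatureDoorSubCurvatureKernelRP

variable {G : Type} [Group G] [TopologicalSpace G] [IsTopologicalGroup G] [CompactSpace G]
  [MeasurableSpace G] [BorelSpace G]

/-! ## §1 Normalising a one-field family at arity `0` -/

omit [TopologicalSpace G] [IsTopologicalGroup G] [CompactSpace G] [MeasurableSpace G] [BorelSpace G] [Group G] in
/-- The family `S₁` with its zero-point functional replaced by evaluation at the empty configuration (all arities `≥ 1` untouched)
exists — a `match` on the arity; no new notion. -/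
theorem exists_normalize (S₁ : SchwingerFamily E4) :
    ∃ S' : SchwingerFamily E4, (∀ F : 𝓢((Fin 0 → E4), ℂ), S' 0 F = F default) ∧ ∀ n, 1 ≤ n → S' n = S₁ n := by
  refine ⟨fun n => match n with
    | 0 => LabelledSchwingerFamily.evalAt (default : Fin 0 → E4)
    | (m + 1) => S₁ (m + 1), fun F => LabelledSchwingerFamily.evalAt_apply _ _, fun n hn => ?_⟩
  obtain ⟨m, rfl⟩ : ∃ m, n = m + 1 := ⟨n - 1, by omega⟩
  rfl

/-- **Normalising at arity `0` keeps `OffDiagLimitAlong`**: the predicate's first and third clauses read arities `≥ 1` only, and its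
density clause at arity `0` holds for evaluation with constant `1` (the volume of the one-point space is a Dirac mass). -/
theorem offDiagLimitAlong_normalize (r : LatticeRep G) {sch : SpeciesScheme (YMSpecies G)} {φ : ℕ → ℕ}
    {S₁ S' : SchwingerFamily E4} (hS₁ : OffDiagLimitAlong r sch φ S₁) (hS'0 : ∀ F : 𝓢((Fin 0 → E4), ℂ), S' 0 F = F default)
    (hS' : ∀ n, 1 ≤ n → S' n = S₁ n) : OffDiagLimitAlong r sch φ S' := by
  obtain ⟨h1, hdens, hconv⟩ := hS₁
  refine ⟨fun F => by rw [hS' 1 le_rfl, h1], fun n δ hδ => ?_,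
    fun n hn F hF => by rw [hS' n (by omega)]; exact hconv n hn F hF⟩
  rcases Nat.eq_zero_or_pos n with rfl | hn
  · refine ⟨1, fun F _ _ => ?_⟩
    have hint : ∫ x : Fin 0 → EuclideanSpace ℝ (Fin 4), ‖F x‖ = ‖F default‖ := by
      rw [Measure.volume_pi_eq_dirac (default : Fin 0 → EuclideanSpace ℝ (Fin 4)), integral_dirac]
    rw [hS'0, one_mul, hint]
  · obtain ⟨B, hB⟩ := hdens n δ hδ
    exact ⟨B, fun F hFc hFs => by rw [hS' n hn]; exact hB F hFc hFs⟩

/-! ## §2 ★ `RPPos` of normalised off-diagonal limit points of the legs -/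

/-- ★ **THE REFLECTION-POSITIVITY RUNG.**  Under `MomentBounds6 G r a` (positive unit map `a → 0`), along every admissible leg scheme and
every subsequence `φ → ∞`, every off-diagonal limit point `S₁` (`OffDiagLimitAlong r sch φ S₁`) which is normalised at arity `0`
(`S₁ 0 F = F default`) is REFLECTION POSITIVE on finite tuples of positive-time off-diagonal test functions: `RPPos S₁`.
Proof: ✓`rpPos_of_softLimit` along the tail `k ↦ φ (k + k₀)` of the scheme lying in the regime `β ≥ β₄`, `a ≤ ℓ₄` of toolkit XIV-b,
whose ✓`exists_planeString_bounds` supplies the small-shift equicontinuity clause from `MomentBounds6`; convergence at arities `0`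
(evaluation), `1` (centred, zero) and `≥ 2` (the hypothesis). [cite: OS1973, §2 (E2)] [cite: OsterwalderSeiler1978, §3]
[cite: GlimmJaffe1987, §6.1] -/
theorem rpPos_of_offDiagLimitAlong (r : LatticeRep G) {a : ℝ → ℝ} (hapos : ∀ β, 0 < a β)
    (ha0 : Tendsto a atTop (𝓝 0)) (hMB : MomentBounds6 G r a) {sch : SpeciesScheme (YMSpecies G)}
    (hsch : IsLegScheme a sch) {φ : ℕ → ℕ} (hφ : Tendsto φ atTop atTop) {S₁ : SchwingerFamily E4}
    (hS₁ : OffDiagLimitAlong r sch φ S₁) (hS0 : ∀ F : 𝓢((Fin 0 → E4), ℂ), S₁ 0 F = F default) : RPPos S₁ := by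
  classical
  obtain ⟨hunits, hβ, hranges⟩ := hsch
  obtain ⟨h1, -, hconv⟩ := hS₁
  obtain ⟨β₄, ℓ₄, K, hℓ₄, hK, H⟩ := exists_planeString_bounds r hMB
  -- the scheme along `φ`: couplings `→ ∞`, units `→ 0`
  have hβφ : Tendsto (fun k => sch.β (φ k)) atTop atTop := hβ.comp hφ
  have haφ : Tendsto (fun k => a (sch.β (φ k))) atTop (𝓝 0) := ha0.comp hβφ
  -- a tail beyond which the regime of toolkit XIV-b holds
  obtain ⟨k₀, hk₀⟩ : ∃ k₀ : ℕ, ∀ k, k₀ ≤ k → β₄ ≤ sch.β (φ k) ∧ a (sch.β (φ k)) ≤ ℓ₄ :=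
    eventually_atTop.1 ((hβφ.eventually_ge_atTop β₄).and (haφ.eventually (eventually_le_nhds hℓ₄)))
  -- the tail sequences
  set βk : ℕ → ℝ := fun k => sch.β (φ (k + k₀)) with hβk
  set Lk : ℕ → ℕ := fun k => sch.L (φ (k + k₀)) with hLk
  set ak : ℕ → ℝ := fun k => a (sch.β (φ (k + k₀))) with hak
  have hak_eq : ∀ k, sch.a (φ (k + k₀)) = ak k := fun k => hunits _
  have hθ : Tendsto (fun k => φ (k + k₀)) atTop atTop := hφ.comp (tendsto_add_atTop_nat k₀)
  have hreg_β : ∀ k, β₄ ≤ βk k := fun k => (hk₀ (k + k₀) (Nat.le_add_left _ _)).1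
  have hreg_ℓ : ∀ k, ak k ≤ ℓ₄ := fun k => (hk₀ (k + k₀) (Nat.le_add_left _ _)).2
  have hreg_pos : ∀ k, 0 < ak k := fun k => hapos _
  have hreg_24 : ∀ k, ak k ≤ 1 / 24 := fun k => by
    have h := (hranges (φ (k + k₀))).2.1
    rwa [hunits] at h
  have hreg_14 : ∀ k, 14 ≤ Lk k := fun k => (hranges (φ (k + k₀))).2.2.1
  have hreg_L : ∀ k, (ak k)⁻¹ * (ak k)⁻¹ ≤ Lk k := fun k => by
    have h := (hranges (φ (k + k₀))).2.2.2
    rwa [hunits] at h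
  have hβ0 : ∀ k, 0 ≤ βk k := fun k => (hranges (φ (k + k₀))).1
  have hL1 : ∀ k, 1 ≤ Lk k := fun k => le_trans (by norm_num) (hreg_14 k)
  have hak0 : Tendsto ak atTop (𝓝 0) := haφ.comp (tendsto_add_atTop_nat k₀)
  have hakL : Tendsto (fun k => ak k * Lk k) atTop atTop := by
    have h := sch.tendsto_L.comp hθ
    refine h.congr fun k => ?_
    simp only [Function.comp_apply, hak_eq, hLk]
  -- convergence at every arity along the tail
  have hlim : ∀ (m : ℕ) (F : 𝓢((Fin m → E4), ℂ)), (2 ≤ m → IsOffDiagonal F) →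
      Tendsto (fun k => latticeDist r.ρ (βk k) (Lk k) (ak k) r.curvature.F
        (wilsonTorusMean r.ρ (βk k) (Lk k) r.curvature.F) m F) atTop (𝓝 (S₁ m F)) := by
    intro m F hF
    rcases Nat.lt_or_ge m 2 with hlt | hm
    · interval_cases m
      · simp_rw [latticeDist_zero_apply r.ρ r.continuous, hS0]
        exact tendsto_const_nhds
      · simp_rw [latticeDist_one_apply, h1]
        exact tendsto_const_nhds
    · have h := (hconv m hm F (hF hm)).comp (tendsto_add_atTop_nat k₀)
      refine h.congr fun k => ?_
      simp only [Function.comp_apply, hak_eq, hβk, hLk]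
  -- the small-shift equicontinuity clause from `MomentBounds6`
  have hdef : ∀ (k m : ℕ), 2 ≤ m → ∀ rr : Fin m → Fin 4 × Fin 4, (∀ i, (rr i).1 < (rr i).2) →
      ∀ F : 𝓢((Fin m → E4), ℂ), IsOffDiagonal F → ∀ c : Fin m → E4, (∀ l, ‖c l‖ ≤ ak k) →
        ‖∑ z ∈ Fintype.piFinset (fun _ : Fin m => box 4 (Lk k)),
            ((torusMomentStr r.ρ (βk k) (Lk k) (fun i U => plaquetteObs r.ρ 0 (rr i).1 (rr i).2 U)
              (fun i => wilsonTorusMean r.ρ (βk k) (Lk k) (fun U => plaquetteObs r.ρ 0 (rr i).1 (rr i).2 U)) z : ℝ) : ℂ) *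
            (F ((fun l => ak k • siteToE (z l)) + c) - F (fun l => ak k • siteToE (z l)))‖ ≤
          2 * ‖c‖ * K ^ m * (SchwartzMap.seminorm ℂ 0 (4 * m + 1) F + SchwartzMap.seminorm ℂ (6 * m) (4 * m + 1) F +
            SchwartzMap.seminorm ℂ 0 1 F + SchwartzMap.seminorm ℂ (6 * m) 1 F + SchwartzMap.seminorm ℂ (10 * m) 1 F) :=
    fun k m hm rr hrr F hF c hc =>
      (H (βk k) (hreg_β k) (hreg_pos k) (hreg_24 k) (hreg_ℓ k) (Lk k) (hreg_14 k) (hreg_L k) m hm rr hrr F hF).2 c hc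
  exact rpPos_of_softLimit r hK hβ0 hL1 hreg_pos hak0 hakL S₁ hlim hdef

/-! ## §3 Every leg-scheme limit point, normalised, is reflection positive -/

/-- **Every off-diagonal limit point of the legs has a reflection-positive normalisation**: a family `S'` with `S' 0 = δ`, `S' n = S₁ n`
for all `n ≥ 1` (so the same two-point function), again an `OffDiagLimitAlong` point along the same scheme, with `RPPos S'`.
[cite: OS1973, §2 (E2)] [cite: GlimmJaffe1987, §6.1] -/
theorem rpPos_normalize_of_offDiagLimitAlong (r : LatticeRep G) {a : ℝ → ℝ} (hapos : ∀ β, 0 < a β)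
    (ha0 : Tendsto a atTop (𝓝 0)) (hMB : MomentBounds6 G r a) {sch : SpeciesScheme (YMSpecies G)}
    (hsch : IsLegScheme a sch) {φ : ℕ → ℕ} (hφ : Tendsto φ atTop atTop) {S₁ : SchwingerFamily E4}
    (hS₁ : OffDiagLimitAlong r sch φ S₁) :
    ∃ S' : SchwingerFamily E4, (∀ F : 𝓢((Fin 0 → E4), ℂ), S' 0 F = F default) ∧ (∀ n, 1 ≤ n → S' n = S₁ n) ∧
      OffDiagLimitAlong r sch φ S' ∧ RPPos S' := by
  obtain ⟨S', hS'0, hS'⟩ := exists_normalize S₁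
  have hS'lim : OffDiagLimitAlong r sch φ S' := offDiagLimitAlong_normalize r hS₁ hS'0 hS'
  exact ⟨S', hS'0, hS', hS'lim, rpPos_of_offDiagLimitAlong r hapos ha0 hMB hsch hφ hS'lim hS'0⟩

/-- **`IsReflectionPositive`** (E2 on time-ordered tuples) of every normalised off-diagonal limit point of the legs. [cite: OS1973, §2 (E2)] -/
theorem isReflectionPositive_of_offDiagLimitAlong (r : LatticeRep G) {a : ℝ → ℝ} (hapos : ∀ β, 0 < a β)
    (ha0 : Tendsto a atTop (𝓝 0)) (hMB : MomentBounds6 G r a) {sch : SpeciesScheme (YMSpecies G)}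
    (hsch : IsLegScheme a sch) {φ : ℕ → ℕ} (hφ : Tendsto φ atTop atTop) {S₁ : SchwingerFamily E4}
    (hS₁ : OffDiagLimitAlong r sch φ S₁) (hS0 : ∀ F : 𝓢((Fin 0 → E4), ℂ), S₁ 0 F = F default) :
    S₁.toLabelled.IsReflectionPositive :=
  isReflectionPositive_of_rpPos (rpPos_of_offDiagLimitAlong r hapos ha0 hMB hsch hφ hS₁ hS0)

/-- **The rung in the crux's quantifier prefix** (`SubCurvatureKernel`'s letters, `Theses/F4SubCurvatureDoor.lean` :338ff): for every
compact simple `G`, representation `r`, positive unit map `a → 0` with `MomentBounds6`, admissible leg scheme, subsequence `φ → ∞` and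
off-diagonal limit point `S₁` normalised at arity `0`, `RPPos S₁`. [cite: OS1973, §2 (E2)] [cite: GlimmJaffe1987, §6.1] -/
theorem subCurvatureKernel_rung_rpPos :
    ∀ (G : Type) [Group G] [TopologicalSpace G] [IsTopologicalGroup G] [CompactSpace G], IsCompactSimpleLieGroup G →
      letI : MeasurableSpace G := borel G; haveI : BorelSpace G := ⟨rfl⟩;
      ∀ (r : LatticeRep G) (a : ℝ → ℝ), (∀ β, 0 < a β) → Tendsto a atTop (nhds 0) → MomentBounds6 G r a →
        ∀ sch : SpeciesScheme (YMSpecies G), IsLegScheme a sch → ∀ φ : ℕ → ℕ, Tendsto φ atTop atTop →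
          ∀ S₁ : SchwingerFamily E4, OffDiagLimitAlong r sch φ S₁ → (∀ F : 𝓢((Fin 0 → E4), ℂ), S₁ 0 F = F default) →
            RPPos S₁ := by
  intro G _ _ _ _ _
  letI : MeasurableSpace G := borel G
  haveI : BorelSpace G := ⟨rfl⟩
  intro r a hapos ha0 hMB sch hsch φ hφ S₁ hS₁ hS0
  exact rpPos_of_offDiagLimitAlong r hapos ha0 hMB hsch hφ hS₁ hS0

end Summit.QuantumFields.YangMills.Theorems.F4SubCurvatureDoorSubCurvatureKernelRP

end
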